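import Summits.BirchSwinnertonDyer.Rank1Residual.GaloisImage.KolyvaginCongruenceRatBot
import Summits.BirchSwinnertonDyer.Rank1Residual.GaloisImage.KolyvaginTransferCocycle
import Summits.BirchSwinnertonDyer.Rank1Residual.GaloisImage.KolyvaginEulerFactorOperatorRat
import HarnessLib

/-!
# The semi-local congruence of the modified derivative classes for `T_p E` over the cyclotomic
# levels of `ℚ` (the input `hvan` of THEOREM D-tr) — file 4b of row T-DER-TR (cell `b2b-bsdres`,
# team n1011, seat p15 GEN 8, OWNERS row T-DER-TR = skel/T-DER-TR.md)

HONEST FRAMING (cell `b2b-bsdres`, run/shared/lean/b2b/bsd-rank1-residual/, verbatim in every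
file): the goal of the cell is to DELETE the COMBINATION-SHAPED residual classes of the
Birch–Swinnerton-Dyer formula for ALL analytic-rank `≤ 1` elliptic curves over `ℚ` — "full BSD
formula for every rank `≤ 1` curve in class `C`" assembled STRICTLY from published theorems — so
that the rank-`≤ 1` remainder becomes exactly the CONSTRUCTION-SHAPED classes, which are TYPED
(missing-input `Prop`s), NOT attempted. This is not "finishing BSD". Team n1011: research route on
the CONSTRUCTION-SHAPED class X4 / §I N11 (route-1 PORT, (P-DER)); TOOL theorems (no definition,
no named fact, no `sorry`).

## What ([MR04] App. A, Lemma A.10 (i) = [Ru00] Cor. 4.8.1, in the tree's Euler-factor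
## convention: the MODIFIED classes take coboundary values at the Frobenius powers above `q`)

For an Euler system `c` of `T = T_pE` over `cyclotomicLevelsRat p S` (Kato type), a level `n`
with `q ∈ n` a Kolyvagin prime of level `k`, an arithmetic Frobenius `Fr` at `q` and the auxiliary
polynomial `E_q = u⁻¹(a_q X − (q+1) X²)` of K4 (`P_q(Fr⁻¹ ∣ T*; F) = (q−1)·E_q(F)` on `T_pE`), the
class `res_{U_n} c_{⊥,mq} − E_q(Fr⁻¹) res_{U_n} c_{⊥,m}` (`q ∉ m`, `U_n ≤ U_{mq}, U_m`) has, at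
every marked element `g = φ^f` (`φ` an arithmetic Frobenius at a prime `𝔔 ∣ q` FIXING `μ_q`,
`φ^f ∈ U_n`), a representative taking the coboundary value `φ^f · w − w`:
`Rat.exists_rep_apply_eq_rho_sub_of_frobenius_pow` — the hypothesis `hvan` of file 3
`Transverse.sub_conjMap_noncommProd_deriv_mem_smul_localVanishing` DISCHARGED for `T_pE`.
Ingredients: p11's E2-b `Congruence.Rat.exists_sub_eq_sub_one_apply_frobenius_pow_bot`
(Perrin-Riou Prop. 2.2.5 (ii), `IsEulerSystem.cores_p`/`cores_cons` BY NAME) at the datum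
`(𝔔, φ)` with `Z_φ = E_q(ρ(φ)⁻¹)`; the operator identity `Fr⁻¹ ≡ φ⁻¹` on `H¹(U_m, T)`
(`φ Fr⁻¹ ∈ I_𝔔 · [Γ, Γ] ≤ U_m`: Mathlib `IsArithFrobAt.conj`/`mul_inv_mem_inertia`,
`level_unramifiedAt`, `commutator_le_level`); and the representative
`Σ_k e_k • (φ^{-k} · x)` of `E_q(φ⁻¹)[x]` (G1 `oneCocycleClass_sumConj`, `sumConj_apply`), whose
value at `φ^f` is `E_q(ρ(φ⁻¹)) x(φ^f)` because `φ` commutes with `φ^f`.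

References: B. Mazur, K. Rubin, *Kolyvagin systems*, Mem. AMS 799 (2004), App. A p. 85 (L. A.10);
B. Perrin-Riou, Ann. Inst. Fourier 48 (1998), Prop. 2.2.5 (ii); K. Rubin, *Euler Systems* (2000),
Cor. 4.8.1.
-/

noncomputable section

open CategoryTheory Function Finset Polynomial Field IsDedekindDomain
open scoped NumberField Pointwise commutatorElement
open Literature.NumberTheory.GaloisRepresentations Literature.NumberTheory.EllipticCurves
open Literature.NumberTheory.EllipticCurves (subgroupConj subgroupConj_apply_coe)
open Summit.BirchSwinnertonDyer.Rank1Residual.GaloisImage.CyclotomicLevel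
open Rat.HeightOneSpectrum

universe u

namespace Summit.BirchSwinnertonDyer.Rank1Residual.GaloisImage

namespace Derivative

namespace Transverse

/-! ### §0 A representative of `res x₁ − res x₂` (generic) -/

section Generic

variable {R : Type u} [CommRing R] [TopologicalSpace R]
variable {G : Type u} [Group G] [TopologicalSpace G] [IsTopologicalGroup G]

/-- **A representative of `res_{H} [x₁] − res_{H} [x₂]` with its values**: for `H ≤ H₁`, `H ≤ H₂`
and explicit cocycles `x₁` on `H₁`, `x₂` on `H₂`, the cocycle `u ↦ x₁(u) − x₂(u)` on `H`
represents `res [x₁] − res [x₂]` (tree `resLe_oneCocycleClass`, stated existentially so that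
concrete instances never carry the pulled-back cocycle term). [folklore] -/
theorem exists_rep_resLe_sub_resLe (X : TopRep.{u} R G) {H H₁ H₂ : Subgroup G} (h₁ : H ≤ H₁)
    (h₂ : H ≤ H₂) (x₁ : contOneCocycles (subgroupRep X H₁))
    (x₂ : contOneCocycles (subgroupRep X H₂)) :
    ∃ ψ : contOneCocycles (subgroupRep X H),
      oneCocycleClass _ ψ =
          resLe X h₁ 1 (oneCocycleClass _ x₁) - resLe X h₂ 1 (oneCocycleClass _ x₂) ∧
        ∀ u : H, ψ.1 u = x₁.1 ⟨u, h₁ u.2⟩ - x₂.1 ⟨u, h₂ u.2⟩ := by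
  refine ⟨contOneCocycles.pullback (subgroupInclusion h₁) (Y := subgroupRep X H)
      (TopRep.ofHom ⟨ContinuousLinearMap.id R X, fun _ => rfl⟩) x₁ -
    contOneCocycles.pullback (subgroupInclusion h₂) (Y := subgroupRep X H)
      (TopRep.ofHom ⟨ContinuousLinearMap.id R X, fun _ => rfl⟩) x₂, ?_, fun u => ?_⟩
  · rw [oneCocycleClass_sub, resLe_oneCocycleClass, resLe_oneCocycleClass]
  · rw [Submodule.coe_sub, ContinuousMap.sub_apply]
    rfl

end Generic

namespace Rat

variable (W : WeierstrassCurve ℚ) [W.IsElliptic] [W.IsGloballyMinimal] {p : ℕ} [Fact p.Prime]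
variable [Module.Free ℤ_[p] (W.tateModule p)] [Module.Finite ℤ_[p] (W.tateModule p)]
  [ContinuousSMul ℤ_[p] (W.tateModule p)]
variable (S : Set (HeightOneSpectrum (𝓞 ℚ)))

/-- **`Fr⁻¹ ≡ φ⁻¹` modulo an unramified abelian level.**  Two arithmetic Frobenii above the same
place `q` — `Fr` at `𝔔₀`, `φ` at `𝔔` — satisfy `Fr⁻¹ φ ∈ U` for every level `U = L.level i m` with
`q ∉ m`, `q` usable: `φ = i · δFrδ⁻¹` with `i ∈ I_𝔔 ≤ U` (unramified) and `δFrδ⁻¹Fr⁻¹ ∈ [Γ,Γ] ≤ U`.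
[folklore] -/
theorem inv_mul_mem_level_of_isArithFrobAt {K : Type u} [Field K] [NumberField K] {ι : Type*}
    [Preorder ι] [OrderBot ι] (L : EulerSystemLevels K ι) (i : ι) (m : L.Ideals)
    {q : HeightOneSpectrum (𝓞 K)} (hq : q ∈ L.primes) (hqm : q ∉ m.1)
    {𝔔₀ 𝔔 : Ideal (absIntegers (𝓞 K) K)} (h𝔔₀ : 𝔔₀ ∈ q.primesAbove) (h𝔔 : 𝔔 ∈ q.primesAbove)
    {Fr φ : absoluteGaloisGroup K} (hFr : IsArithFrobAt (𝓞 K) Fr 𝔔₀)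
    (hφ : IsArithFrobAt (𝓞 K) φ 𝔔) :
    Fr⁻¹ * φ ∈ L.level i m.1 := by
  obtain ⟨δ, hδ⟩ := HeightOneSpectrum.exists_smul_eq_of_mem_primesAbove_holds h𝔔₀ h𝔔
  have hconj : IsArithFrobAt (𝓞 K) (δ * Fr * δ⁻¹) 𝔔 := hδ ▸ hFr.conj δ
  have hi : φ * (δ * Fr * δ⁻¹)⁻¹ ∈ 𝔔.inertia (absoluteGaloisGroup K) := hφ.mul_inv_mem_inertia hconj
  have hiU : φ * (δ * Fr * δ⁻¹)⁻¹ ∈ L.level i m.1 := L.level_unramifiedAt i m hq hqm 𝔔 h𝔔 hi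
  have hcomm : δ * Fr * δ⁻¹ * Fr⁻¹ ∈ L.level i m.1 := by
    refine L.commutator_le_level i m.1 ?_
    have e : δ * Fr * δ⁻¹ * Fr⁻¹ = ⁅δ, Fr⁆ := by rw [commutatorElement_def]
    rw [e, commutator_def]
    exact Subgroup.commutator_mem_commutator (Subgroup.mem_top _) (Subgroup.mem_top _)
  have h : φ * Fr⁻¹ ∈ L.level i m.1 := by
    have e : φ * Fr⁻¹ = (φ * (δ * Fr * δ⁻¹)⁻¹) * (δ * Fr * δ⁻¹ * Fr⁻¹) := by group
    rw [e]
    exact Subgroup.mul_mem _ hiU hcomm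
  have e : Fr⁻¹ * φ = Fr⁻¹ * (φ * Fr⁻¹) * Fr := by group
  rw [e]
  exact (L.normal_level i m.1).conj_mem' _ h Fr

/-- **`hvan` for `T_pE` — the modified class takes a coboundary value at every Frobenius power
above `q`.**  For an Euler system `c` of `T_pE` over `cyclotomicLevelsRat p S` (`p` odd), a
Kolyvagin prime `q` of level `k ≥ 1` with arithmetic Frobenius `Fr`, the unit `u = q` of `ℤ_p` and
`E_q = C u⁻¹ * (C a_q * X − C (q+1) * X^2)`, levels `U_n ≤ U_{mq}`, `U_n ≤ U_m` (`q ∉ m`), and a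
marked element `φ^f ∈ U_n` (`φ` an arithmetic Frobenius at `𝔔 ∣ q` fixing `μ_q`, `f ≠ 0`): there is
a representative of `res c_{⊥,mq} − E_q(Fr⁻¹) res c_{⊥,m}` on `U_n` taking at `φ^f` the value
`φ^f·w − w`.  (E2-b at `(𝔔, φ)` + the operator identity `Fr⁻¹ ≡ φ⁻¹` on `H¹(U_m, T)` + the value of
the representative `Σ e_k • (φ^{-k}·x)` at `φ^f`.)
[cite: MazurRubin2004, App. A, Lemma A.10 (i) (p. 85)]
[cite: PerrinRiou1998AIF, Prop. 2.2.5 (ii)] -/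
theorem exists_rep_apply_eq_rho_sub_of_frobenius_pow (hp2 : p ≠ 2)
    {c : ∀ (i : ℕ) (r : (cyclotomicLevelsRat p S).Ideals),
      H1 (W.tateGaloisRep p (W.continuous_galoisRepTate_holds p)) ((cyclotomicLevelsRat p S).level
          i r.1)}
    (hc : IsEulerSystem (cyclotomicLevelsRat p S)
      (W.tateGaloisRep p (W.continuous_galoisRepTate_holds p)) p c)
    {k : ℕ} (hk : 0 < k) (n m : (cyclotomicLevelsRat p S).Ideals) {q : HeightOneSpectrum (𝓞 ℚ)}
    (hq : q ∈ (cyclotomicLevelsRat p S).primes) (hqm : q ∉ m.1)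
    (hKol : Kato.IsKolyvaginPrime W p k ((primesEquiv q : Nat.Primes) : ℕ))
    (h₁ : (cyclotomicLevelsRat p S).level ⊥ n.1 ≤ (cyclotomicLevelsRat p S).level ⊥ (m.cons q hq).1)
    (h₂ : (cyclotomicLevelsRat p S).level ⊥ n.1 ≤ (cyclotomicLevelsRat p S).level ⊥ m.1)
    {Fr : absoluteGaloisGroup ℚ} (hFr : IsArithFrobAtPlace ℚ q Fr)
    (u : ℤ_[p]ˣ) (hu : (u : ℤ_[p]) = ((primesEquiv q : Nat.Primes) : ℕ))
    {𝔔 : Ideal (absIntegers (𝓞 ℚ) ℚ)} (h𝔔 : 𝔔 ∈ q.primesAbove)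
    {φ : absoluteGaloisGroup ℚ} (hφ : IsArithFrobAt (𝓞 ℚ) φ 𝔔)
    (hφq : φ ∈ (cyclotomicLevelsRat p S).tameLevel q) {f : ℕ} (hf : f ≠ 0)
    (hφn : φ ^ f ∈ (cyclotomicLevelsRat p S).level ⊥ n.1) :
    ∃ (ψ : contOneCocycles (subgroupRep
        (W.tateGaloisRep p (W.continuous_galoisRepTate_holds p)).toTopRep
        ((cyclotomicLevelsRat p S).level ⊥ n.1))) (w : W.tateModule p),
      oneCocycleClass _ ψ =
        resLe (W.tateGaloisRep p (W.continuous_galoisRepTate_holds p)).toTopRep h₁ 1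
            (c ⊥ (m.cons q hq)) -
          aeval (frobeniusInvOp (W.tateGaloisRep p (W.continuous_galoisRepTate_holds p))
            ((cyclotomicLevelsRat p S).level ⊥ n.1) Fr)
            (C (↑u⁻¹ : ℤ_[p]) * (C (W.frobeniusTrace (primesEquiv q) : ℤ_[p]) * X -
              C ((((primesEquiv q : Nat.Primes) : ℕ) : ℤ_[p]) + 1) * X ^ 2))
            (resLe (W.tateGaloisRep p (W.continuous_galoisRepTate_holds p)).toTopRep h₂ 1 (c ⊥ m)) ∧
      ψ.1 ⟨φ ^ f, hφn⟩ =
        (W.tateGaloisRep p (W.continuous_galoisRepTate_holds p)).toTopRep.ρ (φ ^ f) w - w := by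
  classical
  haveI : Fact (Nat.Prime ((primesEquiv q : Nat.Primes) : ℕ)) := ⟨(primesEquiv q).2⟩
  haveI := (cyclotomicLevelsRat p S).normal_level ⊥ n.1
  haveI := (cyclotomicLevelsRat p S).normal_level ⊥ m.1
  haveI := (cyclotomicLevelsRat p S).normal_level ⊥ (m.cons q hq).1
  -- arithmetic at `q`: `q ≠ p`, good reduction, `q ≡ 1 (p^k)`
  have hne : ((primesEquiv q : Nat.Primes) : ℕ) ≠ p := hKol.ne
  have hgood : W.HasGoodReductionAt q :=
    CyclotomicLevel.Rat.hasGoodReductionAt_of_isKolyvaginPrime W hKol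
  have hφP : IsArithFrobAtPlace ℚ q φ := ⟨𝔔, h𝔔, hφ⟩
  obtain ⟨𝔔₀, h𝔔₀, hFr₀⟩ := hFr
  have hφm : φ ^ f ∈ (cyclotomicLevelsRat p S).level ⊥ m.1 := h₂ hφn
  have hφ₀ : φ ^ f ∈ (cyclotomicLevelsRat p S).level ⊥ (m.cons q hq).1 := h₁ hφn
  have hft : ∀ ℓ ∈ m.1, ((primesEquiv q : Nat.Primes) : ℕ) ^ f ≡ 1 [MOD ((primesEquiv ℓ :
      Nat.Primes) : ℕ)] := by
    intro ℓ hℓ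
    have hℓq : ℓ ≠ q := fun h => hqm (h ▸ hℓ)
    haveI : NeZero ((primesEquiv ℓ : Nat.Primes) : ℕ) := ⟨(primesEquiv ℓ).2.ne_zero⟩
    have hne' : ¬ ((primesEquiv q : Nat.Primes) : ℕ) ∣ ((primesEquiv ℓ : Nat.Primes) : ℕ) :=
      fun h => hℓq (primesEquiv.injective (Subtype.ext
        ((Nat.prime_dvd_prime_iff_eq (primesEquiv q).2 (primesEquiv ℓ).2).mp h).symm))
    have hmem : φ ^ f ∈ (cyclotomicLevelsRat p S).tameLevel ℓ := by
      have h := hφm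
      rw [EulerSystemLevels.mem_level_iff] at h
      exact h.2 ℓ hℓ
    rwa [CyclotomicLevel.Rat.cyclotomicLevelsRat_tameLevel,
      CyclotomicLevel.Rat.pow_mem_rootsOfUnityFixer_iff_of_isArithFrobAtPlace hne' hφP] at hmem
  have hfp : p ∣ ((primesEquiv q : Nat.Primes) : ℕ) ^ f - 1 := by
    have h1 : 1 ≤ ((primesEquiv q : Nat.Primes) : ℕ) ^ f :=
      Nat.one_le_iff_ne_zero.mpr (pow_ne_zero f (primesEquiv q).2.ne_zero)
    have hmod : 1 ≡ ((primesEquiv q : Nat.Primes) : ℕ) ^ f [MOD p ^ k] := by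
      have h := hKol.modEq_one.pow f
      rw [one_pow] at h
      exact h.symm
    exact dvd_trans (dvd_pow_self p hk.ne') ((Nat.modEq_iff_dvd' h1).mp hmod)
  -- the operator `Z_ψ = u⁻¹ • (a_q • ρ(ψ⁻¹) − (q+1) • ρ(ψ⁻¹)²)` (K4)
  obtain ⟨w, hw⟩ := Congruence.Rat.exists_sub_eq_sub_one_apply_frobenius_pow_bot W S hp2 hc hk m
    hq hqm hKol h𝔔 hφ hφq hf hft hfp rfl hφ₀
    (fun ψ => (↑u⁻¹ : ℤ_[p]) • ((W.frobeniusTrace (primesEquiv q) : ℤ_[p]) • W.galoisRepTate p ψ⁻¹ -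
      ((((primesEquiv q : Nat.Primes) : ℕ) : ℤ_[p]) + 1) • W.galoisRepTate p ψ⁻¹ ^ 2))
    (fun ψ _ => Derivative.Rat.commute_galoisRepTate_Z W p _ _ _ ψ)
    (fun ψ hψ t => Derivative.Rat.aeval_rubinEulerFactor_apply_eq_nsmul_Z W p hne hgood u hu hψ t)
    (fun ψ g t => Derivative.Rat.Z_conj_apply W p _ _ _ ψ g t)
    (Classical.choose (oneCocycleClass_surjective _ (c ⊥ (m.cons q hq))))
    (Classical.choose_spec (oneCocycleClass_surjective _ (c ⊥ (m.cons q hq))))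
    (Classical.choose (oneCocycleClass_surjective _ (c ⊥ m)))
    (Classical.choose_spec (oneCocycleClass_surjective _ (c ⊥ m)))
  set x₀' := Classical.choose (oneCocycleClass_surjective _ (c ⊥ (m.cons q hq))) with hx₀'def
  have hx₀' : oneCocycleClass _ x₀' = c ⊥ (m.cons q hq) :=
    Classical.choose_spec (oneCocycleClass_surjective _ (c ⊥ (m.cons q hq)))
  set x₀ := Classical.choose (oneCocycleClass_surjective _ (c ⊥ m)) with hx₀def
  have hx₀ : oneCocycleClass _ x₀ = c ⊥ m :=
    Classical.choose_spec (oneCocycleClass_surjective _ (c ⊥ m))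
  -- abbreviations
  set Eql : ℤ_[p][X] := C (↑u⁻¹ : ℤ_[p]) * (C (W.frobeniusTrace (primesEquiv q) : ℤ_[p]) * X -
    C ((((primesEquiv q : Nat.Primes) : ℕ) : ℤ_[p]) + 1) * X ^ 2) with hEql
  have hρ : ∀ (g : absoluteGaloisGroup ℚ) (t : W.tateModule p),
      (W.tateGaloisRep p (W.continuous_galoisRepTate_holds p)).toTopRep.ρ g t =
        W.galoisRepTate p g t := fun _ _ => rfl
  have haeval : ∀ (F : Module.End ℤ_[p] (W.tateModule p)), aeval F Eql =
      (↑u⁻¹ : ℤ_[p]) • ((W.frobeniusTrace (primesEquiv q) : ℤ_[p]) • F -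
        ((((primesEquiv q : Nat.Primes) : ℕ) : ℤ_[p]) + 1) • F ^ 2) := by
    intro F
    simp only [hEql, map_mul, map_sub, aeval_C, aeval_X, map_pow, Algebra.algebraMap_eq_smul_one,
      smul_mul_assoc, one_mul]
  -- the representative `R = Σ_k e_k • (φ^{-k} · x₀)` of `E_q(φ⁻¹)[x₀]` on `U_m`
  set R : contOneCocycles (subgroupRep
      (W.tateGaloisRep p (W.continuous_galoisRepTate_holds p)).toTopRep
      ((cyclotomicLevelsRat p S).level ⊥ m.1)) :=
    ∑ k ∈ range (Eql.natDegree + 1), Eql.coeff k •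
      contOneCocycles.pullback (subgroupConj ((cyclotomicLevelsRat p S).level ⊥ m.1) (φ⁻¹ ^ k))
        (conjRepHom (W.tateGaloisRep p (W.continuous_galoisRepTate_holds p)).toTopRep
          ((cyclotomicLevelsRat p S).level ⊥ m.1) (φ⁻¹ ^ k)) x₀ with hRdef
  have hRclass : oneCocycleClass _ R =
      aeval (frobeniusInvOp (W.tateGaloisRep p (W.continuous_galoisRepTate_holds p))
        ((cyclotomicLevelsRat p S).level ⊥ m.1) Fr) Eql (c ⊥ m) := by
    have hFrφ : Fr⁻¹ * φ ∈ (cyclotomicLevelsRat p S).level ⊥ m.1 :=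
      inv_mul_mem_level_of_isArithFrobAt (cyclotomicLevelsRat p S) ⊥ m hq hqm h𝔔₀ h𝔔 hFr₀ hφ
    rw [← frobeniusInvOp_eq_of_inv_mul_mem
      (W.tateGaloisRep p (W.continuous_galoisRepTate_holds p)) _ hFrφ, ← hx₀, hRdef,
      ← Congruence.aeval_conjMap_oneCocycleClass]
    rfl
  have hRval : R.1 ⟨φ ^ f, hφm⟩ = ((↑u⁻¹ : ℤ_[p]) • ((W.frobeniusTrace (primesEquiv q) : ℤ_[p]) •
      W.galoisRepTate p φ⁻¹ - ((((primesEquiv q : Nat.Primes) : ℕ) : ℤ_[p]) + 1) •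
        W.galoisRepTate p φ⁻¹ ^ 2)) (x₀.1 ⟨φ ^ f, hφm⟩) := by
    have hfix : ∀ k : ℕ, subgroupConj ((cyclotomicLevelsRat p S).level ⊥ m.1) (φ⁻¹ ^ k)
        ⟨φ ^ f, hφm⟩ = ⟨φ ^ f, hφm⟩ := by
      intro k
      apply Subtype.ext
      rw [subgroupConj_apply_coe, inv_pow, inv_inv, (Commute.pow_pow_self φ k f).eq,
        mul_inv_cancel_right]
    rw [hRdef, Congruence.sumConj_apply, ← haeval (W.galoisRepTate p φ⁻¹), aeval_eq_sum_range,
      LinearMap.sum_apply]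
    refine Finset.sum_congr rfl fun k _ => ?_
    rw [hfix k, LinearMap.smul_apply, ← map_pow, hρ]
  -- the representative `ψ = res x₀' − res R` on `U_n`
  obtain ⟨ψ, hψc, hψv⟩ := exists_rep_resLe_sub_resLe
    (W.tateGaloisRep p (W.continuous_galoisRepTate_holds p)).toTopRep h₁ h₂ x₀' R
  refine ⟨ψ, w, ?_, ?_⟩
  · -- the class
    rw [hψc, hx₀', hRclass]
    congr 1
    exact Derivative.apply_aeval_apply_eq_of_comm
      (resLe (W.tateGaloisRep p (W.continuous_galoisRepTate_holds p)).toTopRep h₂ 1).hom.toLinearMap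
      (F := frobeniusInvOp (W.tateGaloisRep p (W.continuous_galoisRepTate_holds p))
        ((cyclotomicLevelsRat p S).level ⊥ m.1) Fr)
      (F' := frobeniusInvOp (W.tateGaloisRep p (W.continuous_galoisRepTate_holds p))
        ((cyclotomicLevelsRat p S).level ⊥ n.1) Fr)
      (fun v => Derivative.resLe_conjMap
        (W.tateGaloisRep p (W.continuous_galoisRepTate_holds p)).toTopRep h₂ Fr⁻¹ v) Eql (c ⊥ m)
  · -- the value at `φ^f`
    rw [hψv]
    change x₀'.1 ⟨φ ^ f, hφ₀⟩ - R.1 ⟨φ ^ f, hφm⟩ = W.galoisRepTate p (φ ^ f) w - w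
    rw [hRval]
    exact hw

end Rat

end Transverse

end Derivative

end Summit.BirchSwinnertonDyer.Rank1Residual.GaloisImage

end
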